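import Literature.NumberTheory.EllipticCurves.PeriodLatticeRationalityLemmasProofs
import HarnessLib

/-!
# The period lattice of a rational weight-`2` cusp form has rational Weierstrass invariants
# (granted a presentation of `℘_Λ(2πi∫f)` and Deligne–Serre (2.7.2))

Topic `NumberTheory/EllipticCurves`; a proofs-only file (theorems only, no definitions, no named
facts). **Main theorem** (`ratCast_g₂_g₃_of_presentation`). Let `f ∈ S₂(Γ₀(N))` be a nonzero cusp
form with rational Fourier coefficients whose period lattice `Λ_f` (`periodLattice f`, Manin 1972;
Cremona 1997, §2.6) is a lattice, `Λ_f = Λ(L)` for a period pair `L`. Assume the conclusion of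
Deligne–Serre 1974, (2.7.2) (the tree's named fact `DeligneSerre1974_span_integralLattice1`) in all
weights, and assume that the `Γ₀(N)`-invariant meromorphic function `x = ℘_Λ(2πi∫f)` is presented
as a quotient `F/G` of diamond-invariant cusp forms on `Γ₁(N)` (i.e. of `Γ₀(N)`-cusp forms; a
presentation exists by Riemann-surface theory — `x` is a meromorphic function on `X₀(N)` — and is
the business of a sibling file). Then **`g₂(Λ_f), g₃(Λ_f) ∈ ℚ`**: the complex torus `ℂ/Λ_f`
is the elliptic curve `y² = 4x³ − g₂x − g₃` *over `ℚ`*, its analytic modular parametrisation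
`τ ↦ (℘(u), ℘′(u))` having Manin constant `1`. (Classically this is a consequence of the
Eichler–Shimura construction of `E_f` over `ℚ` and the rationality of the Manin constant,
Agashe–Ribet–Stein 2006, §2; Knapp 1993, Thm. 11.74 (d) and PDF p. 302: "the full image of cycles
of `X₀(N)` as the set of periods … leads directly to a strong Weil curve". Here it is proved by
descent along `Aut(ℂ)`.)

**Proof** (step A of the descent; the lattice side is `PeriodPair.ratCast_g₂_g₃_of_forall_le`,
`LatticeInclusionRigidityProofs.lean`): for `σ ∈ Aut(ℂ)` and a lattice `M` with invariants
`σ(g₂), σ(g₃)` we show `Λ_f ⊆ M`. Conjugating the presentation gives diamond-invariant forms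
`F', G'` with coefficients `σ(aₙ)` (`CuspFormAutConjProofs.lean`, Deligne–Serre (2.7.4)); the
differential identity `(G·F′ − F·G′)² = (2πi)²f²G(4F³ − g₂FG² − g₃G³)` of the presentation is
transported to `(F', G'; σg₂, σg₃)` (`PeriodLatticeODETransportProofs.lean`: it is a polynomial
identity with rational structure constants between `q`-expansions), so `h = F'/G'` solves
`h′² = u′²(4h³ − σ(g₂)h − σ(g₃))` and is therefore `℘_M(±u + c)` by the uniqueness theorem for
the Weierstrass equation (`WeierstrassPDiffEqProofs.lean`, Whittaker–Watson §20.22), `h` not being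
a constant root (`exists_nondegenerate_of_conj`). Since `h` is `Γ₀(N)`-invariant and
`u(γτ) = u(τ) + {∞, γ∞}_f` (`eichlerIntegral_smul_sub_holds`, Manin 1972, Prop. 1.4), every period
`{∞, γ∞}_f` is a translation symmetry of `℘_M` along the non-constant curve `±u + c`, hence lies in
`M` (`cuspSymbol_mem_of_eq_weierstrassP`); so `Λ_f ⊆ M`.

## References

* A. W. Knapp, *Elliptic Curves*, Princeton 1993: Thm. 11.74 (d), PDF p. 302. [Knapp1993]
* A. Agashe, K. Ribet, W. A. Stein, *The Manin constant*, PAMQ 2 (2006): §2. [AgasheRibetStein2006]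
* G. Shimura, *Introduction to the arithmetic theory of automorphic functions*, 1971: §7.
  [ShimuraIATAF1971]
* Ju. I. Manin, *Parabolic points and zeta functions of modular curves*, 1972: Prop. 1.4.
  [Manin1972]
* P. Deligne, J.-P. Serre, *Formes modulaires de poids 1*, 1974: Prop. 2.7. [DeligneSerreASENS1974]
-/

noncomputable section

open Complex Filter Topology Set Function
open UpperHalfPlane hiding I
open scoped Real Topology Manifold MatrixGroups PeriodPair ModularForm

open Literature.NumberTheory.EllipticCurves

namespace Literature.NumberTheory.EllipticCurves.ModularForms

open CongruenceSubgroup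

variable {N : ℕ} [NeZero N] {k : ℤ}

/-! ### Non-degeneracy of the conjugate quotient -/

/-- **The conjugate quotient is not a constant root of the cubic.** Let `(F, G)` present
`℘_Λ(u)` (`℘_Λ(u)G = F` off the poles, `G ≠ 0`, `f ≠ 0`), and let `F', G'` have coefficients
`σ(aₙ(F)), σ(aₙ(G))`. Then at some point of the half-plane where `G' ≠ 0`, the value of
`h = F'/G'` is not a root of `4X³ − AX − B` (any `A, B`): otherwise `h` would be constant
(`h` maps the connected `{G' ≠ 0}` into a finite set), `F' = e•G'`, hence `F = σ⁻¹(e)•G`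
(`eq_smul_of_conj_eq_smul`) and `℘_Λ ∘ u` would be constant on the open set `{G ≠ 0} ∖ poles`,
contradicting `not_const_weierstrassP_eichlerIntegral`. [folklore] -/
theorem exists_nondegenerate_of_conj (f : CuspForm (Gamma0 N) 2) (hf : f ≠ 0) (L : PeriodPair)
    {F G F' G' : CuspForm (Gamma1 N) k} (σ : ℂ ≃+* ℂ)
    (hFc : ∀ n, cuspCoeff F' n = σ (cuspCoeff F n)) (hGc : ∀ n, cuspCoeff G' n = σ (cuspCoeff G n))
    (hG0 : G ≠ 0)
    (hFG : ∀ τ : ℍ, eichlerIntegral f τ ∉ L.lattice → ℘[L] (eichlerIntegral f τ) * G τ = F τ)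
    (A B : ℂ) :
    ∃ z : ℂ, 0 < z.im ∧ (⇑G' ∘ ofComplex) z ≠ 0 ∧
      4 * ((⇑F' ∘ ofComplex) z / (⇑G' ∘ ofComplex) z) ^ 3 -
        A * ((⇑F' ∘ ofComplex) z / (⇑G' ∘ ofComplex) z) - B ≠ 0 := by
  classical
  by_contra! hall
  have hG'0 : G' ≠ 0 := ne_zero_of_conj hGc hG0
  have hF'1 := isCuspFunction_one_gamma1 F'
  have hG'1 := isCuspFunction_one_gamma1 G'
  set V : Set ℂ := {z : ℂ | 0 < z.im ∧ (⇑G' ∘ ofComplex) z ≠ 0} with hV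
  have hVo : IsOpen V := hG'1.differentiableOn_comp_ofComplex.continuousOn.isOpen_inter_preimage
    isOpen_upperHalfPlaneSet isOpen_compl_singleton
  have hVc : ({z : ℂ | 0 < z.im} \ V).Countable := by
    refine (countable_zeros_cuspForm G' hG'0).mono ?_
    rintro z ⟨hz, hzV⟩
    exact ⟨hz, by by_contra h; exact hzV ⟨hz, h⟩⟩
  have hVsub : V ⊆ {z : ℂ | 0 < z.im} := fun z hz ↦ hz.1
  have hVpre : IsPreconnected V := by
    have := isPreconnected_diff_of_countable convex_setOf_im_pos isOpen_upperHalfPlaneSet hVc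
    rwa [Set.sdiff_sdiff_cancel_left hVsub] at this
  obtain ⟨z₁, hz₁⟩ := nonempty_diff_of_countable hVc
  have hz₁V : z₁ ∈ V := by
    by_contra h; exact hz₁.2 ⟨hz₁.1, h⟩
  -- `h = F'/G'` is constant on `V`
  set R : Polynomial ℂ := 4 * Polynomial.X ^ 3 - Polynomial.C A * Polynomial.X - Polynomial.C B with hR
  have hR0 : R ≠ 0 := by
    intro h0
    have h3 : R.coeff 3 = 4 := by simp [hR]
    rw [h0, Polynomial.coeff_zero] at h3
    norm_num at h3
  set w : ℂ → ℂ := fun z ↦ (⇑F' ∘ ofComplex) z / (⇑G' ∘ ofComplex) z with hw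
  have hwc : ContinuousOn w V := fun z hz ↦
    (((hF'1.analyticAt_comp_ofComplex hz.1).div (hG'1.analyticAt_comp_ofComplex hz.1)
      hz.2).continuousAt).continuousWithinAt
  have hmaps : MapsTo w V (R.roots.toFinset : Set ℂ) := by
    intro z hz
    rw [Finset.mem_coe, Multiset.mem_toFinset, Polynomial.mem_roots hR0, Polynomial.IsRoot.def]
    simp only [hR, Polynomial.eval_sub, Polynomial.eval_mul, Polynomial.eval_pow, Polynomial.eval_X,
      Polynomial.eval_C, Polynomial.eval_ofNat]
    exact hall z hz.1 hz.2
  set e : ℂ := w z₁ with he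
  have hconst : ∀ z ∈ V, w z = e := fun z hz ↦
    hVpre.constant_of_mapsTo (Finset.finite_toSet _).isDiscrete hwc hmaps hz hz₁V
  -- `F' = e • G'` on the half-plane, hence as cusp forms
  have han : AnalyticOnNhd ℂ (fun z ↦ (⇑F' ∘ ofComplex) z - e * (⇑G' ∘ ofComplex) z)
      {z : ℂ | 0 < z.im} := fun z hz ↦
    (hF'1.analyticAt_comp_ofComplex hz).sub (analyticAt_const.mul (hG'1.analyticAt_comp_ofComplex hz))
  have hev : (fun z ↦ (⇑F' ∘ ofComplex) z - e * (⇑G' ∘ ofComplex) z) =ᶠ[𝓝 z₁] 0 := by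
    filter_upwards [hVo.mem_nhds hz₁V] with z hz
    have h1 := hconst z hz
    simp only [hw] at h1
    rw [div_eq_iff hz.2] at h1
    show (⇑F' ∘ ofComplex) z - e * (⇑G' ∘ ofComplex) z = 0
    rw [h1, sub_self]
  have hzero := han.eqOn_zero_of_preconnected_of_eventuallyEq_zero convex_setOf_im_pos.isPreconnected
    hz₁.1 hev
  have hFG' : F' = e • G' := by
    apply DFunLike.ext
    intro τ
    have := hzero τ.im_pos
    simp only [comp_apply, ofComplex_apply, Pi.zero_apply, sub_eq_zero] at this
    simpa using this
  -- hence `F = σ⁻¹(e) • G`, and `℘_Λ(u)` is constant where `G ≠ 0`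
  have hFG2 : F = σ.symm e • G := eq_smul_of_conj_eq_smul hFc hGc hFG'
  have hG1 := isCuspFunction_one_gamma1 G
  set W : Set ℂ := {z : ℂ | 0 < z.im ∧ eichlerIntegral f (ofComplex z) ∉ L.lattice} ∩
    {z : ℂ | 0 < z.im ∧ (⇑G ∘ ofComplex) z ≠ 0} with hW
  have hWo : IsOpen W := (isOpen_setOf_eichlerIntegral_notMem_lattice f L).inter
    (hG1.differentiableOn_comp_ofComplex.continuousOn.isOpen_inter_preimage isOpen_upperHalfPlaneSet
      isOpen_compl_singleton)
  have hWc : ({z : ℂ | 0 < z.im} \ W).Countable := by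
    refine ((countable_setOf_eichlerIntegral_mem_lattice f L hf).union
      (countable_zeros_cuspForm G hG0)).mono ?_
    rintro z ⟨hz, hzW⟩
    by_cases h1 : eichlerIntegral f (ofComplex z) ∈ L.lattice
    · exact Or.inl ⟨hz, h1⟩
    · right
      refine ⟨hz, ?_⟩
      by_contra h2
      exact hzW ⟨⟨hz, h1⟩, ⟨hz, h2⟩⟩
  obtain ⟨z₂, hz₂⟩ := nonempty_diff_of_countable hWc
  have hz₂W : z₂ ∈ W := by
    by_contra h; exact hz₂.2 ⟨hz₂.1, h⟩
  refine not_const_weierstrassP_eichlerIntegral f hf L hWo ⟨z₂, hz₂W⟩ (fun z hz ↦ hz.1) (σ.symm e)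
    fun z hz ↦ ?_
  have h1 := hFG (ofComplex z) hz.1.2
  rw [hFG2, CuspForm.IsGLPos.smul_apply, smul_eq_mul] at h1
  have hGz : (G : ℍ → ℂ) (ofComplex z) ≠ 0 := hz.2.2
  exact mul_right_cancel₀ hGz h1

/-! ### Invariance and periods: `{∞, γ∞}_f ∈ M` -/

/-- A diamond-invariant `Γ₁(N)`-cusp form is invariant under `Γ₀(N)`:
`F(γτ) = (cτ + d)^k F(τ)` (`⟨d⟩F = F ∣[k] γ`, `coe_diamondOp_eq_slash`). [folklore] -/
theorem apply_smul_eq_of_diamondOp_eq (F : CuspForm (Gamma1 N) k)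
    (hF : ∀ d : (ZMod N)ˣ, diamondOp N k (d : ZMod N) F = F) (γ : Gamma0 N) (τ : ℍ) :
    F ((γ : SL(2, ℤ)) • τ) = F τ * denom (γ : SL(2, ℤ)) τ ^ k := by
  have hu := isUnit_Gamma0Map N γ
  have h1 : diamondOp N k (Gamma0Map N γ) F = F := by
    have := hF hu.unit
    rwa [IsUnit.unit_spec] at this
  have h2 := coe_diamondOp_eq_slash N k γ F
  rw [h1] at h2
  have h3 := congrFun h2 τ
  rw [← ModularForm.SL_slash, ModularForm.SL_slash_apply] at h3
  have hd : denom (γ : SL(2, ℤ)) τ ≠ 0 := denom_ne_zero _ τ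
  rw [h3, mul_assoc, ← zpow_add₀ hd, neg_add_cancel, zpow_zero, mul_one]

/-- **Periods are translation symmetries.** Let `F', G'` be diamond-invariant cusp forms on
`Γ₁(N)`, `M` a lattice, `ε = ±1`, `c ∈ ℂ`, and suppose `F'(z)/G'(z) = ℘_M(εu(z) + c)` at every
`z` of the half-plane with `G'(z) ≠ 0` and `εu(z) + c ∉ M` (`u = 2πi∫f`, `f ≠ 0`). Then every
period `{∞, γ∞}_f`, `γ ∈ Γ₀(N)`, lies in `M`: at a generic base point, `F'/G'` is invariant under
`τ ↦ γτ` while `u(γτ) = u(τ) + {∞, γ∞}_f` (`eichlerIntegral_smul_sub_holds`), so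
`℘_M(ελ + ζ) = ℘_M(ζ)` along the non-constant curve `ζ = εu + c`, and
`mem_lattice_of_weierstrassP_comp_add_eventuallyEq` applies. [cite: Manin1972, Prop. 1.4] -/
theorem cuspSymbol_mem_of_eq_weierstrassP (f : CuspForm (Gamma0 N) 2) (hf : f ≠ 0) (M : PeriodPair)
    (F' G' : CuspForm (Gamma1 N) k) (hF' : ∀ d : (ZMod N)ˣ, diamondOp N k (d : ZMod N) F' = F')
    (hG' : ∀ d : (ZMod N)ˣ, diamondOp N k (d : ZMod N) G' = G') (hG'0 : G' ≠ 0) {ε c : ℂ}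
    (hε : ε = 1 ∨ ε = -1)
    (hglob : ∀ z : ℂ, 0 < z.im → (⇑G' ∘ ofComplex) z ≠ 0 →
      ε * eichlerIntegral f (ofComplex z) + c ∉ M.lattice →
        (⇑F' ∘ ofComplex) z / (⇑G' ∘ ofComplex) z = ℘[M] (ε * eichlerIntegral f (ofComplex z) + c))
    (γ : Gamma0 N) : cuspSymbol f γ ∈ M.lattice := by
  have hε0 : ε ≠ 0 := by rcases hε with rfl | rfl <;> norm_num
  have hεsq : ε * ε = 1 := by rcases hε with rfl | rfl <;> norm_num
  set lam := cuspSymbol f γ with hlam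
  set U : ℂ → ℂ := fun w ↦ eichlerIntegral f (ofComplex w) with hU
  have hG'1 := isCuspFunction_one_gamma1 G'
  -- a generic base point
  have hbad : (({z : ℂ | 0 < z.im} ∩ (⇑G' ∘ ofComplex) ⁻¹' {0}) ∪
      {z : ℂ | 0 < z.im ∧ ε * U z + c ∈ M.lattice} ∪
      {z : ℂ | 0 < z.im ∧ ε * (U z + lam) + c ∈ M.lattice}).Countable := by
    refine ((countable_zeros_cuspForm G' hG'0).union ?_).union ?_
    · have hsub : {z : ℂ | 0 < z.im ∧ ε * U z + c ∈ M.lattice} ⊆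
          ⋃ m ∈ (M.lattice : Set ℂ), ({z : ℂ | 0 < z.im} ∩ U ⁻¹' {ε * (m - c)}) := by
        rintro z ⟨hz, hm⟩
        simp only [mem_iUnion, mem_inter_iff, mem_setOf_eq, mem_preimage, mem_singleton_iff,
          SetLike.mem_coe, exists_prop]
        refine ⟨ε * U z + c, hm, hz, ?_⟩
        linear_combination (-(U z)) * hεsq
      exact (M.countable_lattice.biUnion fun m _ ↦ countable_fiber_eichlerIntegral f hf _).mono hsub
    · have hsub : {z : ℂ | 0 < z.im ∧ ε * (U z + lam) + c ∈ M.lattice} ⊆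
          ⋃ m ∈ (M.lattice : Set ℂ), ({z : ℂ | 0 < z.im} ∩ U ⁻¹' {ε * (m - c) - lam}) := by
        rintro z ⟨hz, hm⟩
        simp only [mem_iUnion, mem_inter_iff, mem_setOf_eq, mem_preimage, mem_singleton_iff,
          SetLike.mem_coe, exists_prop]
        refine ⟨ε * (U z + lam) + c, hm, hz, ?_⟩
        linear_combination (-(U z) - lam) * hεsq
      exact (M.countable_lattice.biUnion fun m _ ↦ countable_fiber_eichlerIntegral f hf _).mono hsub
  obtain ⟨z₁, hz₁⟩ := nonempty_diff_of_countable hbad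
  have hz₁im : 0 < z₁.im := hz₁.1
  simp only [Set.mem_sdiff, mem_union, mem_inter_iff, mem_preimage, mem_singleton_iff,
    mem_setOf_eq, not_or, not_and] at hz₁
  obtain ⟨⟨hz₁G, hz₁c⟩, hz₁lc⟩ := hz₁.2
  replace hz₁G : (⇑G' ∘ ofComplex) z₁ ≠ 0 := hz₁G hz₁im
  replace hz₁c : ε * U z₁ + c ∉ M.lattice := hz₁c hz₁im
  replace hz₁lc : ε * (U z₁ + lam) + c ∉ M.lattice := hz₁lc hz₁im
  -- the identity near `z₁`
  have hΛo : IsOpen ((M.lattice : Set ℂ)ᶜ) := M.isClosed_lattice.isOpen_compl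
  have hUc : ContinuousAt U z₁ := (analyticAt_eichlerIntegral_comp_ofComplex f hz₁im).continuousAt
  have hGc : ContinuousAt (⇑G' ∘ ofComplex) z₁ := (hG'1.analyticAt_comp_ofComplex hz₁im).continuousAt
  have ev0 : ∀ᶠ z in 𝓝 z₁, 0 < z.im := isOpen_upperHalfPlaneSet.mem_nhds hz₁im
  have ev1 : ∀ᶠ z in 𝓝 z₁, (⇑G' ∘ ofComplex) z ≠ 0 := hGc.eventually_ne hz₁G
  have ev2 : ∀ᶠ z in 𝓝 z₁, ε * U z + c ∉ M.lattice :=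
    ((continuous_const.mul continuous_id).add continuous_const).continuousAt.comp hUc
      |>.preimage_mem_nhds (hΛo.mem_nhds hz₁c)
  have ev3 : ∀ᶠ z in 𝓝 z₁, ε * (U z + lam) + c ∉ M.lattice :=
    ((continuous_const.mul (continuous_id.add continuous_const)).add continuous_const).continuousAt.comp
      hUc |>.preimage_mem_nhds (hΛo.mem_nhds hz₁lc)
  have hper : ∀ᶠ z in 𝓝 z₁, ℘[M] (ε * lam + (ε * U z + c)) = ℘[M] (ε * U z + c) := by
    filter_upwards [ev0, ev1, ev2, ev3] with z h0 h1 h2 h3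
    set τ : ℍ := ⟨z, h0⟩ with hτ
    have hτz : ofComplex z = τ := ofComplex_apply_of_im_pos h0
    -- the translate `γτ`
    set z' : ℂ := (((γ : SL(2, ℤ)) • τ : ℍ) : ℂ) with hz'
    have h0' : 0 < z'.im := ((γ : SL(2, ℤ)) • τ).im_pos
    have hτz' : ofComplex z' = (γ : SL(2, ℤ)) • τ := by
      rw [hz', ofComplex_apply]
    have hU' : U z' = U z + lam := by
      simp only [hU, hτz', hτz]
      have := eichlerIntegral_smul_sub_holds f γ τ
      linear_combination this
    have hG'z : (G' : ℍ → ℂ) τ ≠ 0 := by simpa [comp_apply, hτz] using h1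
    have h1' : (⇑G' ∘ ofComplex) z' ≠ 0 := by
      simp only [comp_apply, hτz', apply_smul_eq_of_diamondOp_eq G' hG' γ τ]
      exact mul_ne_zero hG'z (zpow_ne_zero _ (denom_ne_zero _ τ))
    have h3' : ε * U z' + c ∉ M.lattice := by rwa [hU']
    have hq := hglob z' h0' h1' h3'
    have hq0 := hglob z h0 h1 h2
    -- invariance of the quotient
    have hquot : (⇑F' ∘ ofComplex) z' / (⇑G' ∘ ofComplex) z' =
        (⇑F' ∘ ofComplex) z / (⇑G' ∘ ofComplex) z := by
      simp only [comp_apply, hτz', hτz, apply_smul_eq_of_diamondOp_eq F' hF' γ τ,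
        apply_smul_eq_of_diamondOp_eq G' hG' γ τ]
      rw [mul_div_mul_right _ _ (zpow_ne_zero _ (denom_ne_zero _ τ))]
    rw [show ε * lam + (ε * U z + c) = ε * U z' + c by rw [hU']; ring, ← hq, hquot, hq0]
  have hζ : AnalyticAt ℂ (fun z : ℂ ↦ ε * U z + c) z₁ :=
    (analyticAt_const.mul (analyticAt_eichlerIntegral_comp_ofComplex f hz₁im)).add analyticAt_const
  have hζnc : ¬ ∀ᶠ z in 𝓝 z₁, ε * U z + c = ε * U z₁ + c := by
    intro h
    apply not_eventually_const_eichlerIntegral f hf hz₁im (U z₁)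
    filter_upwards [h] with z hz
    have : ε * (U z - U z₁) = 0 := by linear_combination hz
    simpa [hε0, sub_eq_zero] using this
  have hmem := M.mem_lattice_of_weierstrassP_comp_add_eventuallyEq hζ hζnc hz₁c
    (by rw [show ε * lam + (ε * U z₁ + c) = ε * (U z₁ + lam) + c by ring]; exact hz₁lc) hper
  rcases hε with rfl | rfl
  · simpa using hmem
  · simpa using neg_mem hmem

/-! ### The main theorem -/

/-- **Rational invariants of the period lattice** (granted a presentation and Deligne–Serre
(2.7.2)). Let `f ∈ S₂(Γ₀(N))`, `f ≠ 0`, have rational Fourier coefficients, let `L` be a period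
pair with `Λ(L) = Λ_f` (`periodLattice f`), assume `span_ℂ L_k = S_k(Γ₁(N))` for all `k ≥ 1`
(`DeligneSerre1974_span_integralLattice1 N k`), and assume a presentation
`℘_Λ(u(τ))·G(τ) = F(τ)` (`u(τ) ∉ Λ`) with diamond-invariant `F, G ∈ S_k(Γ₁(N))`, `G ≠ 0`. Then
`g₂(L), g₃(L) ∈ ℚ`. See the module docstring for the proof (descent along `Aut(ℂ)`:
`PeriodPair.ratCast_g₂_g₃_of_forall_le` with step A supplied by the conjugate presentation, the
transported differential equation, the uniqueness theorem for the Weierstrass equation and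
`cuspSymbol_mem_of_eq_weierstrassP`). [cite: Knapp1993, Thm. 11.74 (d) and PDF p. 302]
[cite: AgasheRibetStein2006, §2 (p. 618)] -/
theorem ratCast_g₂_g₃_of_presentation (f : CuspForm (Gamma0 N) 2) (hf : f ≠ 0)
    (hrat : ∀ n, ∃ q : ℚ, (q : ℂ) = cuspCoeff f n) (L : PeriodPair)
    (hL : ∀ x, x ∈ L.lattice ↔ x ∈ periodLattice f)
    (hDS : ∀ k : ℤ, DeligneSerre1974_span_integralLattice1 N k)
    (hpres : ∃ (k : ℤ) (F G : CuspForm (Gamma1 N) k), 1 ≤ k ∧ G ≠ 0 ∧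
      (∀ d : (ZMod N)ˣ, diamondOp N k (d : ZMod N) F = F) ∧
      (∀ d : (ZMod N)ˣ, diamondOp N k (d : ZMod N) G = G) ∧
      ∀ τ : ℍ, eichlerIntegral f τ ∉ L.lattice → ℘[L] (eichlerIntegral f τ) * G τ = F τ) :
    (∃ q : ℚ, (q : ℂ) = L.g₂) ∧ (∃ q : ℚ, (q : ℂ) = L.g₃) := by
  refine L.ratCast_g₂_g₃_of_forall_le fun σ M hM₂ hM₃ ↦ ?_
  obtain ⟨k, F, G, hk, hG0, hFd, hGd, hFG⟩ := hpres
  have hspan := hDS k hk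
  obtain ⟨F', hF'c, hF'dia⟩ := exists_cuspForm_conj hspan σ F
  obtain ⟨G', hG'c, hG'dia⟩ := exists_cuspForm_conj hspan σ G
  have hF'd : ∀ d : (ZMod N)ˣ, diamondOp N k (d : ZMod N) F' = F' := fun d ↦
    diamondOp_conj_eq_self hF'c (hF'dia d) (hFd d)
  have hG'd : ∀ d : (ZMod N)ˣ, diamondOp N k (d : ZMod N) G' = G' := fun d ↦
    diamondOp_conj_eq_self hG'c (hG'dia d) (hGd d)
  have hG'0 : G' ≠ 0 := ne_zero_of_conj hG'c hG0
  have hF'1 := isCuspFunction_one_gamma1 F'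
  have hG'1 := isCuspFunction_one_gamma1 G'
  -- the transported differential identity and the equation for `h = F'/G'`
  have hode0 := odeFun_eq_zero_of_presentation f hf L F G hFG
  have hode1 := odeFun_conj_eq_zero f hrat σ hF'c hG'c L.g₂ L.g₃ hode0
  rw [← hM₂, ← hM₃] at hode1
  set V : Set ℂ := {z : ℂ | 0 < z.im ∧ (⇑G' ∘ ofComplex) z ≠ 0} with hV
  have hVo : IsOpen V := hG'1.differentiableOn_comp_ofComplex.continuousOn.isOpen_inter_preimage
    isOpen_upperHalfPlaneSet isOpen_compl_singleton
  have hVC : V ⊆ {z : ℂ | 0 < z.im} := fun z hz ↦ hz.1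
  have hcount : ({z : ℂ | 0 < z.im} \ V).Countable := by
    refine (countable_zeros_cuspForm G' hG'0).mono ?_
    rintro z ⟨hz, hzV⟩
    exact ⟨hz, by by_contra h; exact hzV ⟨hz, h⟩⟩
  have hwan : AnalyticOnNhd ℂ (fun z : ℂ ↦ (⇑F' ∘ ofComplex) z / (⇑G' ∘ ofComplex) z) V :=
    fun z hz ↦ (hF'1.analyticAt_comp_ofComplex hz.1).div (hG'1.analyticAt_comp_ofComplex hz.1) hz.2
  have hvan : AnalyticOnNhd ℂ (fun z : ℂ ↦ eichlerIntegral f (ofComplex z)) V :=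
    fun z hz ↦ analyticAt_eichlerIntegral_comp_ofComplex f hz.1
  have hode : ∀ z ∈ V, deriv (fun w : ℂ ↦ (⇑F' ∘ ofComplex) w / (⇑G' ∘ ofComplex) w) z ^ 2 =
      deriv (fun w : ℂ ↦ eichlerIntegral f (ofComplex w)) z ^ 2 *
        (4 * ((⇑F' ∘ ofComplex) z / (⇑G' ∘ ofComplex) z) ^ 3 -
          M.g₂ * ((⇑F' ∘ ofComplex) z / (⇑G' ∘ ofComplex) z) - M.g₃) :=
    fun z hz ↦ deriv_div_sq_of_odeFun_eq_zero f F' G' M.g₂ M.g₃ hode1 hz.1 hz.2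
  obtain ⟨z₀, hz₀im, hz₀G, h0⟩ := exists_nondegenerate_of_conj f hf L σ hF'c hG'c hG0 hFG M.g₂ M.g₃
  -- the uniqueness theorem for the Weierstrass equation
  obtain ⟨ε, hε, c, -, hglob⟩ := M.exists_eq_weierstrassP_of_deriv_sq convex_setOf_im_pos
    isOpen_upperHalfPlaneSet hVo hVC hcount hwan hvan hode ⟨hz₀im, hz₀G⟩ h0
  -- every period lies in `M`
  have hper : ∀ γ : Gamma0 N, cuspSymbol f γ ∈ M.lattice :=
    cuspSymbol_mem_of_eq_weierstrassP f hf M F' G' hF'd hG'd hG'0 hε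
      (fun z hz hGz hc ↦ hglob z ⟨hz, hGz⟩ hc)
  have hsub : periodLattice f ≤ M.lattice.toAddSubgroup := by
    rw [periodLattice, AddSubgroup.closure_le]
    rintro _ ⟨γ, rfl⟩
    exact hper γ
  intro x hx
  exact hsub ((hL x).mp hx)

end Literature.NumberTheory.EllipticCurves.ModularForms

end
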